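import Literature.Analysis.FluidPDE.NormalisedPressureL2Bound
import Literature.Analysis.FluidPDE.HarmonicBallMeanValue
import Literature.Analysis.FluidPDE.BiotSavartNewtonKernel
import Literature.Analysis.FluidPDE.NewtonPotentialRepresentation
import HarnessLib

/-!
# The regularised Newtonian kernel is the Newtonian potential of its Laplacian:
`Φ_ε = Γ ⋆ ΔΦ_ε`, and Stein's smoothing identity for the regularised Riesz transforms

Analysis/FluidPDE proof file (one auxiliary definition, everything PROVED), third layer of the
discharge of the named fact `Literature.Analysis.FluidPDE.stein1970_normalisedPressure_ae_Lp_bound`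
(`LocalLerayPressureDecomposition.lean`; Stein 1970, Ch. II §4.2 Thm. 3 / §4.5 Thm. 4 for the
Riesz-type kernels of the normalised pressure). Stein's proof of the almost-everywhere
convergence of the truncated singular integrals (§4.5, Theorem 4) rests on the **Lemma** of
§4.5.2: the truncated kernel is `K_ε = T(φ_ε) - Φ^{(ε)}` with `φ` a smooth bump and `Φ`
integrable with a radial decreasing majorant, whence `T_ε f = (Tf) ⋆ φ_ε - f ⋆ Φ^{(ε)}` and the
maximal bound `T*f ≤ M(Tf) + C Mf` by the Hardy–Littlewood maximal function. For the kernels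
`∂ₐ∂ₐΓ` of the pressure the tree's regularisation `Φ_ε = newtonReg ε` (the smooth far-field
Newtonian kernel at scale `ε`, `NormalisedPressureL2Bound`) provides this structure *exactly*:
its Laplacian `λ_ε = ΔΦ_ε = newtonFarLaplacian (ε/2) ε` is a smooth bump of unit mass supported
in `|z| ≤ ε`, and

  **`Φ_ε(y) = ∫ λ_ε(z) Γ(y - z) dz`  for every `y ≠ 0`**  (`newtonReg_eq_integral_newtonFarLaplacian_mul`),

so that the regularised Hessian convolution of a `C²_c` density `h` is the `λ_ε`-average of the
(scale-free) Newtonian potential of `∂ₐ∂ₐh`: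

  **`H^a_ε h(x) = ∫ λ_ε(z) F^a[h](x - z) dz`,  `F^a[h](w) = ∫ Γ(w - t) ∂ₐ∂ₐh(t) dt`**
  (`hessConv_eq_integral_newtonFarLaplacian_mul_newtonHessPotential`).

This is the form of Stein's Lemma used by the next layer (`RieszPressureMaximal`): since
`T^a_ε h = E^a_ε h - H^a_ε h` (`RieszPressureTruncations`), `|λ_ε| ≤ ε⁻³ sup|λ₁|` and
`F^a[h] = (|a|²/3) h - T^a h`, it gives `T*h ≤ C (M|h| + M|T^a h|)`.

## Proofs

* *Outside the ball* (`ε < |y|`): the ball mean value property of the tree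
  (`eq_integral_newtonFarLaplacian_mul_of_laplacian_eq_zero`, Gilbarg–Trudinger Thm. 2.1 in the
  weighted radial form with weight `λ_ε`) applied to `Φ_δ`, `2δ = |y| - ε`, which is `C²`,
  harmonic on `B(y, ε)` and agrees with `Γ` at `y` and on `y - supp λ_ε`
  (`newtonReg_eq_integral_newtonFarLaplacian_mul_of_lt`).
* *All scales at once*: `Φ_ε - Φ_R ∈ C^∞_c` with `Δ(Φ_ε - Φ_R) = λ_ε - λ_R`, so Green's
  representation `ψ(y) = ∫ Γ(y - z) Δψ(z) dz` (`integral_newtonKernel_mul_laplacian`) gives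
  `Φ_ε(y) - Φ_R(y) = ∫ (λ_ε - λ_R)(z) Γ(y - z) dz` for **every** `y`; with `R < |y|` the first
  item identifies `Φ_R(y)`, whence the identity at every `y ≠ 0` (no Liouville theorem needed).
* *The smoothing identity*: `H^a_ε h(x) = ∫ Φ_ε(x - t) ∂ₐ∂ₐh(t) dt` (two integrations by parts,
  `hessConv_eq_integral_newtonReg_mul`), insert the first display for `t ≠ x` and exchange the
  integrals (Fubini; the joint integrability is seen after the measure-preserving shear
  `(t, z) ↦ (t, x - t - z)`, which turns the integrand into
  `∂ₐ∂ₐh(t) λ_ε(x - t - w) Γ(w)`, dominated by `‖λ_ε‖_∞ |∂ₐ∂ₐh(t)| · 1_{|w| ≤ R'} |Γ(w)|`).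

## Mathlib / tree search

Tree: `newtonReg`, `newtonReg_eq_newtonKernel`, `laplacian_newtonReg(_eq_zero)`,
`contDiff_newtonReg`, `hessConv_eq_integral_newtonReg_mul`, `integrable_newtonKernel_mul`
(`NormalisedPressureL2Bound`); `eq_integral_newtonFarLaplacian_mul_of_laplacian_eq_zero`
(`HarmonicBallMeanValue`); `integral_newtonKernel_mul_laplacian` (`BiotSavartNewtonKernel`);
`newtonFarLaplacian_eq_zero_of_gt`, `hasCompactSupport_newtonFarLaplacian`,
`continuous_newtonFarLaplacian`, `measurable_newtonKernel` (`NewtonKernel`, `NewtonPotential`);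
`NewtonPotentialRepresentation.locallyIntegrable_newtonKernel`; `continuous_fderiv_fderiv_apply`,
`hasCompactSupport_fderiv_fderiv_apply` (`HessianLaplacian`). Mathlib:
`MeasurePreserving.skew_product`, `MeasurePreserving.integrable_comp_of_integrable`,
`Integrable.mul_prod`, `integral_integral_swap`, `ContDiffAt.laplacian_sub`.

## References

* E. M. Stein, *Singular integrals and differentiability properties of functions*, Princeton
  Math. Series 30 (1970): Ch. II §4.5, Theorem 4 and its Lemma (§4.5.2, (31)–(32)); Ch. III
  §1.2–1.3 (the kernels `∂²Γ/∂xᵢ∂xⱼ`). [`Stein1971`]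
* D. Gilbarg, N. S. Trudinger, *Elliptic partial differential equations of second order*
  (2001), Thm. 2.1, (2.17). [`GilbargTrudinger2001`]
-/

noncomputable section

open MeasureTheory Set Filter Topology Function Metric
open scoped ENNReal NNReal RealInnerProductSpace Laplacian

namespace Literature.Analysis.FluidPDE

/-- Local notation for physical space `ℝ³ = EuclideanSpace ℝ (Fin 3)`. -/
local notation "ℝ³" => EuclideanSpace ℝ (Fin 3)

/-! ## `Φ_ε = Γ ⋆ λ_ε` off the origin -/

section NewtonSmoothing

variable {ε R : ℝ}

/-- The integrand `z ↦ λ_ε(z) Γ(y - z)` is integrable (`λ_ε ∈ C_c`, `Γ ∈ L¹_loc`). [folklore] -/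
theorem integrable_newtonFarLaplacian_mul_newtonKernel (hε : 0 < ε) (y : ℝ³) :
    Integrable fun z => newtonFarLaplacian (ε / 2) ε z * newtonKernel (y - z) := by
  have h := integrable_newtonKernel_mul (continuous_newtonFarLaplacian (half_pos_lt hε).1
    (half_pos_lt hε).2) (hasCompactSupport_newtonFarLaplacian (half_pos_lt hε).1.le
    (half_pos_lt hε).2) y
  exact h.congr (Eventually.of_forall fun z => mul_comm _ _)

/-- **`Φ_ε(y) = ∫ λ_ε(z) Γ(y - z) dz` for `|y| > ε`** — the ball mean value property with weight
`λ_ε = ΔΦ_ε` (supported in `|z| ≤ ε`) applied to `Φ_δ`, `2δ = |y| - ε`, which is `C²`, harmonic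
on `B(y, ε)`, and equal to `Γ` at `y` and at the points `y - z`, `|z| ≤ ε`.
[cite: GilbargTrudinger2001, Thm 2.1] -/
theorem newtonReg_eq_integral_newtonFarLaplacian_mul_of_lt (hε : 0 < ε) {y : ℝ³} (hy : ε < ‖y‖) :
    newtonReg ε y = ∫ z, newtonFarLaplacian (ε / 2) ε z * newtonKernel (y - z) := by
  set δ : ℝ := (‖y‖ - ε) / 2 with hδ
  have hδ0 : 0 < δ := by rw [hδ]; linarith
  have hδy : δ ≤ ‖y‖ := by rw [hδ]; linarith [hε.le]
  -- `Φ_δ` is harmonic on `B(y, ε)`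
  have hΔ : ∀ w ∈ ball y ε, (Δ (newtonReg δ)) w = 0 := by
    intro w hw
    refine laplacian_newtonReg_eq_zero hδ0 ?_
    rw [mem_ball, dist_eq_norm] at hw
    have h1 : ‖y‖ ≤ ‖w‖ + ‖w - y‖ := by
      have := norm_sub_norm_le y w
      rw [← norm_neg (y - w), neg_sub] at this
      linarith
    rw [hδ]
    linarith
  have hmv := eq_integral_newtonFarLaplacian_mul_of_laplacian_eq_zero (half_pos_lt hε).1
    (half_pos_lt hε).2 (contDiff_newtonReg δ (n := 2)) hΔ
  rw [newtonReg_eq_newtonKernel hδ0 hδy] at hmv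
  rw [newtonReg_eq_newtonKernel hε hy.le, hmv]
  refine integral_congr_ae (Eventually.of_forall fun z => ?_)
  show newtonFarLaplacian (ε / 2) ε z * newtonReg δ (y - z) =
    newtonFarLaplacian (ε / 2) ε z * newtonKernel (y - z)
  by_cases hz : ε < ‖z‖
  · rw [newtonFarLaplacian_eq_zero_of_gt (half_pos_lt hε).1.le (half_pos_lt hε).2 hz,
      zero_mul, zero_mul]
  · have hz' : ‖z‖ ≤ ε := not_lt.1 hz
    have hyz : δ ≤ ‖y - z‖ := by
      have h1 : ‖y‖ ≤ ‖y - z‖ + ‖z‖ := by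
        have := norm_sub_norm_le y (y - z)
        rw [sub_sub_cancel] at this
        linarith
      rw [hδ]
      linarith
    rw [newtonReg_eq_newtonKernel hδ0 hyz]

/-- `Φ_ε - Φ_R` has compact support (both are `Γ` off the ball of radius `max ε R`). [folklore] -/
theorem hasCompactSupport_newtonReg_sub (hε : 0 < ε) (hR : 0 < R) :
    HasCompactSupport (fun z => newtonReg ε z - newtonReg R z) := by
  refine HasCompactSupport.intro (isCompact_closedBall (0 : ℝ³) (max ε R)) fun z hz => ?_
  rw [mem_closedBall_zero_iff, not_le] at hz
  rw [newtonReg_eq_newtonKernel hε ((le_max_left ε R).trans hz.le),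
    newtonReg_eq_newtonKernel hR ((le_max_right ε R).trans hz.le), sub_self]

/-- **All scales at once** (Green's representation of the compactly supported smooth function
`Φ_ε - Φ_R`): for every `y`,
`Φ_ε(y) - Φ_R(y) = ∫ λ_ε(z) Γ(y-z) dz - ∫ λ_R(z) Γ(y-z) dz`. [cite: GilbargTrudinger2001, (2.17)] -/
theorem newtonReg_sub_newtonReg_eq (hε : 0 < ε) (hR : 0 < R) (y : ℝ³) :
    newtonReg ε y - newtonReg R y =
      (∫ z, newtonFarLaplacian (ε / 2) ε z * newtonKernel (y - z)) -
        ∫ z, newtonFarLaplacian (R / 2) R z * newtonKernel (y - z) := by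
  set ψ : ℝ³ → ℝ := fun z => newtonReg ε z - newtonReg R z with hψ
  have hψ2 : ContDiff ℝ 2 ψ := (contDiff_newtonReg ε).sub (contDiff_newtonReg R)
  have hψc : HasCompactSupport ψ := hasCompactSupport_newtonReg_sub hε hR
  have hGreen := integral_newtonKernel_mul_laplacian hψ2 hψc y
  have hΔψ : ∀ z, (Δ ψ) z = newtonFarLaplacian (ε / 2) ε z - newtonFarLaplacian (R / 2) R z := by
    intro z
    have h1 : (Δ ψ) z = (Δ (newtonReg ε)) z - (Δ (newtonReg R)) z :=
      (contDiff_newtonReg ε (n := 2)).contDiffAt.laplacian_sub (contDiff_newtonReg R (n := 2)).contDiffAt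
    rw [h1, laplacian_newtonReg hε, laplacian_newtonReg hR]
  have hψy : ψ y = newtonReg ε y - newtonReg R y := rfl
  rw [← hψy, ← hGreen, ← integral_sub (integrable_newtonFarLaplacian_mul_newtonKernel hε y)
    (integrable_newtonFarLaplacian_mul_newtonKernel hR y)]
  refine integral_congr_ae (Eventually.of_forall fun z => ?_)
  show newtonKernel (y - z) * (Δ ψ) z = _
  rw [hΔψ z]
  ring

/-- **The regularised Newtonian kernel is the Newtonian potential of its Laplacian, off the
origin:** `Φ_ε(y) = ∫ λ_ε(z) Γ(y - z) dz` for every `ε > 0` and every `y ≠ 0`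
(`λ_ε = ΔΦ_ε = newtonFarLaplacian (ε/2) ε`; combine the previous two lemmas with `2R = |y|`).
[cite: Stein1971, Ch. II §4.5.2 (31)] -/
theorem newtonReg_eq_integral_newtonFarLaplacian_mul (hε : 0 < ε) {y : ℝ³} (hy : y ≠ 0) :
    newtonReg ε y = ∫ z, newtonFarLaplacian (ε / 2) ε z * newtonKernel (y - z) := by
  have hy' : 0 < ‖y‖ := norm_pos_iff.2 hy
  set R : ℝ := ‖y‖ / 2 with hR
  have hR0 : 0 < R := by positivity
  have hRy : R < ‖y‖ := by rw [hR]; linarith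
  have h1 := newtonReg_sub_newtonReg_eq hε hR0 y
  have h2 := newtonReg_eq_integral_newtonFarLaplacian_mul_of_lt hR0 hRy
  linarith

end NewtonSmoothing

/-! ## Stein's smoothing identity for the regularised Hessian convolutions -/

section SteinIdentity

variable {ε : ℝ} {h : ℝ³ → ℝ}

/-- **The Newtonian potential of the second directional derivative** of a density,
`F^a[h](x) = ∫ Γ(x - t) ∂ₐ∂ₐh(t) dt` (the `ε → 0` limit of `H^a_ε h = ∫ Φ_ε(x-t) ∂ₐ∂ₐh(t) dt`,
`tendsto_integral_newtonReg_mul`; for `h ∈ C²_c` it is `(|a|²/3) h - T^a h` with `T^a` the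
principal-value Riesz-type operator, next layer). Auxiliary definition.
[cite: Stein1971, Ch. III §1.3 (the operator ∂²/∂xᵢ∂xⱼ Δ⁻¹)] -/
def newtonHessPotential (h : ℝ³ → ℝ) (a x : ℝ³) : ℝ :=
  ∫ t, newtonKernel (x - t) * fderiv ℝ (fun s => fderiv ℝ h s a) t a

/-- Unfolding `newtonHessPotential`. [folklore] -/
theorem newtonHessPotential_apply (h : ℝ³ → ℝ) (a x : ℝ³) :
    newtonHessPotential h a x = ∫ t, newtonKernel (x - t) * fderiv ℝ (fun s => fderiv ℝ h s a) t a :=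
  rfl

/-- The shear `(t, z) ↦ (t, x - t - z)` preserves Lebesgue measure on `ℝ³ × ℝ³`. [folklore] -/
theorem measurePreserving_subShear (x : ℝ³) :
    MeasurePreserving (fun p : ℝ³ × ℝ³ => (p.1, x - p.1 - p.2))
      ((volume : Measure ℝ³).prod volume) ((volume : Measure ℝ³).prod volume) := by
  refine MeasurePreserving.skew_product (f := id) (MeasurePreserving.id volume)
    (g := fun t z => x - t - z) ?_ (Eventually.of_forall fun t => ?_)
  · exact (measurable_const.sub measurable_fst).sub measurable_snd
  · exact (Measure.measurePreserving_sub_left volume (x - t)).map_eq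

/-- A uniform bound for the bump `λ^{r₀,r₁}` (continuous with compact support). [folklore] -/
theorem exists_bound_newtonFarLaplacian {r₀ r₁ : ℝ} (h₀ : 0 < r₀) (h₁ : r₀ < r₁) :
    ∃ Λ : ℝ, 0 ≤ Λ ∧ ∀ z : ℝ³, |newtonFarLaplacian r₀ r₁ z| ≤ Λ := by
  obtain ⟨Λ, hΛ⟩ := (continuous_newtonFarLaplacian h₀ h₁).bounded_above_of_compact_support
    (hasCompactSupport_newtonFarLaplacian h₀.le h₁)
  exact ⟨max Λ 0, le_max_right _ _, fun z => by
    rw [← Real.norm_eq_abs]; exact (hΛ z).trans (le_max_left _ _)⟩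

/-- **Joint integrability for Fubini.** For `g ∈ C_c(ℝ³)` and `ε > 0`, the function
`(t, z) ↦ g(t) λ_ε(z) Γ(x - t - z)` is integrable on `ℝ³ × ℝ³` (after the shear
`w = x - t - z` it is dominated by `‖λ_ε‖_∞ |g(t)| · 1_{|w| ≤ R'} |Γ(w)|`,
`R' = |x| + R_g + ε`). [folklore] -/
theorem integrable_mul_newtonFarLaplacian_mul_newtonKernel (hε : 0 < ε) {g : ℝ³ → ℝ}
    (hg : Continuous g) (hgc : HasCompactSupport g) (x : ℝ³) :
    Integrable (fun p : ℝ³ × ℝ³ => g p.1 * (newtonFarLaplacian (ε / 2) ε p.2 * newtonKernel (x - p.1 - p.2)))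
      ((volume : Measure ℝ³).prod volume) := by
  have h₀ := (half_pos_lt hε).1
  have h₁ := (half_pos_lt hε).2
  set lam := newtonFarLaplacian (ε / 2) ε with hlam
  obtain ⟨Λ, hΛ0, hΛ⟩ := exists_bound_newtonFarLaplacian h₀ h₁
  obtain ⟨R_g, hRg⟩ : ∃ R_g : ℝ, tsupport g ⊆ closedBall (0 : ℝ³) R_g :=
    (hgc.isCompact.isBounded).subset_closedBall 0
  set R' : ℝ := ‖x‖ + R_g + ε with hR'
  -- the sheared integrand and its domination
  set G' : ℝ³ × ℝ³ → ℝ := fun p => g p.1 * (lam (x - p.1 - p.2) * newtonKernel p.2) with hG'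
  have hG'm : AEStronglyMeasurable G' ((volume : Measure ℝ³).prod volume) := by
    have h1 : Measurable fun p : ℝ³ × ℝ³ => g p.1 := hg.measurable.comp measurable_fst
    have h2 : Measurable fun p : ℝ³ × ℝ³ => lam (x - p.1 - p.2) :=
      (continuous_newtonFarLaplacian h₀ h₁).measurable.comp
        ((measurable_const.sub measurable_fst).sub measurable_snd)
    have h3 : Measurable fun p : ℝ³ × ℝ³ => newtonKernel p.2 := measurable_newtonKernel.comp measurable_snd
    exact (h1.mul (h2.mul h3)).aestronglyMeasurable
  have hΓloc : IntegrableOn (fun w => |newtonKernel w|) (closedBall (0 : ℝ³) R') volume :=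
    (NewtonPotentialRepresentation.locallyIntegrable_newtonKernel.integrableOn_isCompact
      (isCompact_closedBall 0 R')).abs
  have hD2 : Integrable ((closedBall (0 : ℝ³) R').indicator fun w => |newtonKernel w|) volume :=
    (integrable_indicator_iff measurableSet_closedBall).2 hΓloc
  have hD1 : Integrable (fun t => Λ * |g t|) volume :=
    ((hg.integrable_of_hasCompactSupport hgc).abs).const_mul Λ
  have hD : Integrable (fun p : ℝ³ × ℝ³ => (Λ * |g p.1|) *
      (closedBall (0 : ℝ³) R').indicator (fun w => |newtonKernel w|) p.2)
      ((volume : Measure ℝ³).prod volume) := hD1.mul_prod hD2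
  have hdom : ∀ p : ℝ³ × ℝ³, ‖G' p‖ ≤ (Λ * |g p.1|) *
      (closedBall (0 : ℝ³) R').indicator (fun w => |newtonKernel w|) p.2 := by
    rintro ⟨t, w⟩
    simp only [hG', Real.norm_eq_abs]
    by_cases hgt : g t = 0
    · rw [hgt, zero_mul, abs_zero]
      exact mul_nonneg (mul_nonneg hΛ0 le_rfl) (indicator_nonneg (fun _ _ => abs_nonneg _) _)
    by_cases hl : lam (x - t - w) = 0
    · rw [hl, zero_mul, mul_zero, abs_zero]
      exact mul_nonneg (mul_nonneg hΛ0 (abs_nonneg _)) (indicator_nonneg (fun _ _ => abs_nonneg _) _)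
    -- both factors are nonzero: `‖t‖ ≤ R_g` and `‖x - t - w‖ ≤ ε`, so `‖w‖ ≤ R'`
    have ht : ‖t‖ ≤ R_g := by
      have := hRg (subset_tsupport _ (mem_support.2 hgt))
      rwa [mem_closedBall_zero_iff] at this
    have hxtw : ‖x - t - w‖ ≤ ε := by
      by_contra hc
      exact hl (newtonFarLaplacian_eq_zero_of_gt h₀.le h₁ (not_le.1 hc))
    have hw : w ∈ closedBall (0 : ℝ³) R' := by
      rw [mem_closedBall_zero_iff]
      have e : w = (x - t) - (x - t - w) := by abel
      calc ‖w‖ = ‖(x - t) - (x - t - w)‖ := by rw [← e]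
        _ ≤ ‖x - t‖ + ‖x - t - w‖ := norm_sub_le _ _
        _ ≤ (‖x‖ + ‖t‖) + ε := add_le_add (norm_sub_le _ _) hxtw
        _ ≤ R' := by rw [hR']; linarith
    rw [indicator_of_mem hw, abs_mul, abs_mul]
    calc |g t| * (|lam (x - t - w)| * |newtonKernel w|)
        ≤ |g t| * (Λ * |newtonKernel w|) := by gcongr; exact hΛ _
      _ = Λ * |g t| * |newtonKernel w| := by ring
  have hG'int : Integrable G' ((volume : Measure ℝ³).prod volume) :=
    hD.mono' hG'm (Eventually.of_forall hdom)
  -- undo the shear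
  have hcomp := (measurePreserving_subShear x).integrable_comp_of_integrable hG'int
  refine hcomp.congr (Eventually.of_forall fun p => ?_)
  rcases p with ⟨t, z⟩
  simp only [comp_apply, hG', sub_sub_cancel]

/-- **Stein's smoothing identity for the regularised Hessian convolutions** (the Lemma of
Stein 1970, Ch. II §4.5.2 for the kernels `∂ₐ∂ₐΓ`, in the exact form provided by the tree's
regularisation): for `h ∈ C²_c(ℝ³)`, `ε > 0`, and all `a`, `x`,
`H^a_ε h(x) = ∫ λ_ε(z) F^a[h](x - z) dz`, `λ_ε = ΔΦ_ε`, `F^a[h] = Γ ⋆ ∂ₐ∂ₐh`.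
[cite: Stein1971, Ch. II §4.5.2 Lemma, (31)–(32)] -/
theorem hessConv_eq_integral_newtonFarLaplacian_mul_newtonHessPotential (hε : 0 < ε)
    (hh : ContDiff ℝ 2 h) (hhc : HasCompactSupport h) (a x : ℝ³) :
    hessConv ε h a x = ∫ z, newtonFarLaplacian (ε / 2) ε z * newtonHessPotential h a (x - z) := by
  set g : ℝ³ → ℝ := fun t => fderiv ℝ (fun s => fderiv ℝ h s a) t a with hg_def
  have hg : Continuous g := continuous_fderiv_fderiv_apply hh a a
  have hgc : HasCompactSupport g := hasCompactSupport_fderiv_fderiv_apply hhc a a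
  set lam := newtonFarLaplacian (ε / 2) ε with hlam
  -- step 1: two integrations by parts
  rw [hessConv_eq_integral_newtonReg_mul ε hh hhc a x]
  -- step 2: insert `Φ_ε(x - t) = ∫ λ_ε(z) Γ(x - t - z) dz` for `t ≠ x`
  have hae : (fun t => newtonReg ε (x - t) * g t) =ᵐ[volume]
      fun t => ∫ z, g t * (lam z * newtonKernel (x - t - z)) := by
    have hx : ∀ᵐ t ∂(volume : Measure ℝ³), t ≠ x := by
      have h0 : (volume : Measure ℝ³) {x} = 0 := measure_singleton x
      rw [ae_iff]
      simp only [ne_eq, not_not, setOf_eq_eq_singleton]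
      exact h0
    filter_upwards [hx] with t ht
    have hne : x - t ≠ 0 := sub_ne_zero.2 (Ne.symm ht)
    rw [newtonReg_eq_integral_newtonFarLaplacian_mul hε hne, mul_comm, ← integral_const_mul]
  rw [integral_congr_ae hae]
  -- step 3: Fubini
  have hG := integrable_mul_newtonFarLaplacian_mul_newtonKernel hε hg hgc x
  rw [integral_integral_swap hG]
  -- step 4: identify the inner integral
  refine integral_congr_ae (Eventually.of_forall fun z => ?_)
  show ∫ t, g t * (lam z * newtonKernel (x - t - z)) = lam z * newtonHessPotential h a (x - z)
  rw [newtonHessPotential_apply, ← integral_const_mul]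
  refine integral_congr_ae (Eventually.of_forall fun t => ?_)
  show g t * (lam z * newtonKernel (x - t - z)) = lam z * (newtonKernel (x - z - t) * g t)
  rw [show x - t - z = x - z - t by abel]
  ring

end SteinIdentity

end Literature.Analysis.FluidPDE
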